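import Literature.Topology.FourManifolds.BoundaryConnectedSum
import HarnessLib

/-!
# Boundary connected sums: proofs

Sibling proofs file of `Literature/Topology/FourManifolds/BoundaryConnectedSum.lean` (no new
definition, no statement changed). It discharges the named fact
`Literature.Topology.FourManifolds.compactSpace_of_isOpenGluing_boundaryConnectedSumRel` (a boundary connected sum of compact
manifolds is compact): the glued manifold is the union of the images of the compact sets
`X ∖ h₁ {‖v‖ < 1/2}` and `Y ∖ h₂ {‖v‖ < 1/2}`, because a point `h₁ (t • v)` with `t < 1/2` is
identified with `h₂ ((1 - t) • v)`, `1 - t > 1/2` — the same bookkeeping as for connected sums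
(Kosinski, *Differential Manifolds* (1993), VI.1; Juhász, *Differential and Low-Dimensional
Topology* (2023), Def. 1.47).

## Main statements (all proved)

* `Literature.Topology.FourManifolds.compactSpace_of_isOpenGluing_boundaryConnectedSumRel_holds`: the discharge.
* `Literature.Topology.FourManifolds.mem_image_union_of_boundaryConnectedSumRel`: the covering bookkeeping.
* `Literature.Topology.FourManifolds.isOpen_image_halfBall_of_isOpen_range`, `Literature.Topology.FourManifolds.isCompact_preimage_compl_halfBall`.

## References

* A. Kosinski, *Differential Manifolds* (1993), VI.1.
* A. Juhász, *Differential and Low-Dimensional Topology*, LMS Student Texts 104 (2023), Def. 1.47.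
-/

open scoped Manifold ContDiff Topology
open Set Function

noncomputable section

namespace Literature.Topology.FourManifolds

universe u

section CompactProof

variable {n : ℕ} [NeZero n]

/-- The image of an open half-ball `{‖v‖ < r}` of the closed half space under a half-disc with
open range (a topological embedding `h` with `range h` open, hence an open embedding) is open.
[folklore] -/
theorem isOpen_image_halfBall_of_isOpen_range {X : Type*} [TopologicalSpace X]
    {h : EuclideanHalfSpace n → X} (he : Topology.IsEmbedding h) (ho : IsOpen (range h)) (r : ℝ) :
    IsOpen (h '' {v | ‖v.val‖ < r}) :=
  (Topology.IsOpenEmbedding.mk he ho).isOpenMap _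
    (isOpen_lt (continuous_norm.comp continuous_subtype_val) continuous_const)

/-- Bookkeeping for compactness (and, later, connectedness) of boundary connected sums: in an
open gluing along `boundaryConnectedSumRel h₁ h₂`, every point `jA a` of the first piece lies
either in the image of `X ∖ h₁ {‖v‖ < 1/2}` or in the image of `Y ∖ h₂ {‖v‖ < 1/2}` — a point
`a = h₁ (t • v)` with `t < 1/2` is identified with `h₂ ((1 - t) • v)`, `1 - t > 1/2` (as in the
proof of `IsConnectedSum.compactSpace`; Kosinski, *Differential Manifolds*, VI.1). Only
injectivity of the second half-disc is used. [folklore] -/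
theorem mem_image_union_of_boundaryConnectedSumRel {X Y P : Type*} [TopologicalSpace X]
    [T1Space X] [TopologicalSpace Y] [T1Space Y]
    {h₁ : EuclideanHalfSpace n → X} {h₂ : EuclideanHalfSpace n → Y}
    (hinj₂ : Injective h₂) {jA : puncture h₁ → P} {jB : puncture h₂ → P}
    (hR : ∀ a b, jA a = jB b ↔ boundaryConnectedSumRel h₁ h₂ a b) (a : puncture h₁) :
    jA a ∈ jA '' (Subtype.val ⁻¹' (h₁ '' {v | ‖v.val‖ < 2⁻¹})ᶜ) ∪
      jB '' (Subtype.val ⁻¹' (h₂ '' {v | ‖v.val‖ < 2⁻¹})ᶜ) := by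
  by_cases ha : (a : X) ∈ (h₁ '' {v | ‖v.val‖ < 2⁻¹})ᶜ
  · exact Or.inl ⟨a, ha, rfl⟩
  right
  rw [mem_compl_iff, not_not] at ha
  obtain ⟨w, hw, hwa⟩ := ha
  have hw0 : w ≠ 0 := by
    rintro rfl
    exact a.2 hwa.symm
  set t : ℝ := ‖w.val‖ with ht
  have ht0 : 0 < t := by
    rw [ht, norm_pos_iff]
    exact fun h => hw0 (EuclideanHalfSpace.ext _ _ h)
  have ht2 : t < 2⁻¹ := hw
  -- the unit vector `v = t⁻¹ • w`, so that `w = t • v`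
  set v : EuclideanHalfSpace n := EuclideanHalfSpace.dilate t⁻¹ w with hv
  have hv1 : ‖v.val‖ = 1 := by
    rw [hv, EuclideanHalfSpace.val_dilate_of_nonneg (inv_nonneg.2 ht0.le), norm_smul,
      Real.norm_of_nonneg (inv_nonneg.2 ht0.le), ← ht, inv_mul_cancel₀ ht0.ne']
  have hwv : w = EuclideanHalfSpace.dilate t v := by
    rw [hv, EuclideanHalfSpace.dilate_dilate ht0.le (inv_nonneg.2 ht0.le), mul_inv_cancel₀ ht0.ne',
      EuclideanHalfSpace.dilate_one]
  -- the partner `b = h₂ ((1 - t) • v)` in the second piece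
  have h1t : 0 < 1 - t := by linarith
  set b : Y := h₂ (EuclideanHalfSpace.dilate (1 - t) v) with hb
  have hb0 : b ≠ h₂ 0 := fun h =>
    EuclideanHalfSpace.dilate_ne_zero h1t hv1 (hinj₂ h)
  have hab : jA a = jB ⟨b, hb0⟩ :=
    (hR a ⟨b, hb0⟩).2 ⟨v, t, hv1, ⟨ht0, by linarith⟩, by rw [← hwa, hwv], rfl⟩
  refine ⟨⟨b, hb0⟩, ?_, hab.symm⟩
  -- `b ∉ h₂ {‖u‖ < 1/2}` since `‖(1 - t) • v‖ = 1 - t > 1/2`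
  rintro ⟨u, hu, hub⟩
  have hu' : u = EuclideanHalfSpace.dilate (1 - t) v := hinj₂ (hub.trans rfl)
  rw [hu', mem_setOf_eq, EuclideanHalfSpace.norm_val_dilate h1t.le hv1] at hu
  linarith

/-- The complement of the open half-ball of radius `1/2` of a half-disc, pulled back to the
punctured piece `X ∖ {h 0}`, is compact when `X` is compact: it is closed in `X` (the half-ball
is open, `isOpen_image_halfBall_of_isOpen_range`), avoids the puncture, and the punctured piece
carries the subspace topology. [folklore] -/
theorem isCompact_preimage_compl_halfBall {X : Type*} [TopologicalSpace X] [T1Space X]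
    [CompactSpace X] {h : EuclideanHalfSpace n → X} (he : Topology.IsEmbedding h)
    (ho : IsOpen (range h)) :
    IsCompact ((Subtype.val : puncture h → X) ⁻¹' (h '' {v | ‖v.val‖ < 2⁻¹})ᶜ) := by
  rw [Subtype.isCompact_iff, image_preimage_eq_inter_range, Subtype.range_coe]
  have hsub : (h '' {v | ‖v.val‖ < 2⁻¹})ᶜ ⊆ (puncture h : Set X) := by
    intro x hx h0
    have h0' : x = h 0 := h0
    refine hx ⟨0, ?_, h0'.symm⟩
    change ‖(0 : EuclideanHalfSpace n).val‖ < 2⁻¹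
    rw [show (0 : EuclideanHalfSpace n).val = 0 from rfl, norm_zero]
    norm_num
  rw [inter_eq_left.2 hsub]
  exact (isOpen_image_halfBall_of_isOpen_range he ho _).isClosed_compl.isCompact

/-- **Discharge of `Literature.Topology.FourManifolds.compactSpace_of_isOpenGluing_boundaryConnectedSumRel`**: a boundary
connected sum (open gluing of the punctured pieces along `boundaryConnectedSumRel h₁ h₂`, for
half-discs with open ranges) of compact `X`, `Y` is compact — it is the union of the images of
the compact sets `X ∖ h₁ {‖v‖ < 1/2}` and `Y ∖ h₂ {‖v‖ < 1/2}`
(`mem_image_union_of_boundaryConnectedSumRel`, applied to the gluing and to its symmetric form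
via `boundaryConnectedSumRel_swap`). Kosinski, *Differential Manifolds* (1993), VI.1 (the same
argument as for connected sums). [cite: Juhasz2023, Def. 1.47] -/
theorem compactSpace_of_isOpenGluing_boundaryConnectedSumRel_holds :
    compactSpace_of_isOpenGluing_boundaryConnectedSumRel.{u} := by
  intro n _ X Y P _ _ _ _ _ _ _ _ _ _ h₁ h₂ e₁ o₁ e₂ o₂ hG
  have hG' : IsOpenGluing (𝓡∂ n) (𝓡∂ n) (𝓡∂ n) (A := puncture h₂) (B := puncture h₁) (P := P)
      (boundaryConnectedSumRel h₂ h₁) := by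
    rw [← boundaryConnectedSumRel_swap]
    exact hG.symm
  obtain ⟨jA, jB, hjA, -, hjB, -, hU, hR⟩ := hG
  have hi₁ : Injective h₁ := e₁.isEmbedding.injective
  have hi₂ : Injective h₂ := e₂.isEmbedding.injective
  have hK₁ := isCompact_preimage_compl_halfBall e₁.isEmbedding o₁
  have hK₂ := isCompact_preimage_compl_halfBall e₂.isEmbedding o₂
  refine ⟨?_⟩
  have hcov : (univ : Set P) ⊆
      jA '' (Subtype.val ⁻¹' (h₁ '' {v | ‖v.val‖ < 2⁻¹})ᶜ) ∪
        jB '' (Subtype.val ⁻¹' (h₂ '' {v | ‖v.val‖ < 2⁻¹})ᶜ) := by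
    intro p _
    rcases (hU.symm ▸ mem_univ p : p ∈ range jA ∪ range jB) with ⟨a, rfl⟩ | ⟨b, rfl⟩
    · exact mem_image_union_of_boundaryConnectedSumRel hi₂ hR a
    · have hR' : ∀ b a, jB b = jA a ↔ boundaryConnectedSumRel h₂ h₁ b a := fun b a => by
        rw [eq_comm, hR a b, ← boundaryConnectedSumRel_swap]
      exact union_comm _ _ ▸ mem_image_union_of_boundaryConnectedSumRel hi₁ hR' b
  exact ((hK₁.image hjA.isEmbedding.continuous).union
    (hK₂.image hjB.isEmbedding.continuous)).of_isClosed_subset isClosed_univ hcov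

end CompactProof

end Literature.Topology.FourManifolds

end
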